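import Literature.Topology.FourManifolds.CurveFamilyIsotopy
import Literature.Topology.FourManifolds.FoxMilnorChart
import Literature.Topology.FourManifolds.SphereIsometryDiffeotopy
import HarnessLib

/-!
# Knots from closed curves in the stereographic chart, and their isotopies

Topic `Literature/Topology/FourManifolds`; infrastructure for the proof programme of the
Fox–Milnor fact `Literature.Topology.FourManifolds.Knot.exists_isConnectedSum_isConcordant`
(the second summand is inserted after an inversion of its chart picture; the inverted picture
must define a knot isotopic to the original one). Everything here is proved; no named fact is
introduced.

* `IsChartLoop k` — a `C^∞`, `1`-periodic, regular curve `k : ℝ → ℝ³`, injective modulo the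
  period; read through `φ = ψ⁻¹` it is a simple regular loop on `𝕊³` (`IsChartLoop.loop`,
  `CurveFamilyIsotopy.lean`) and defines the knot `IsChartLoop.toKnot` with
  `ψ (toKnot (circlePt t)) = k t`.
* `IsChartLoop.comp_of_injective` — images under injective immersions of `ℝ³`;
  `IsChartLoop.isIsotopic_of_family` — knots of chart loops joined by a jointly smooth family of
  chart loops are isotopic (`IsRegularLoop.isIsotopic_of_family_eq`).
* Isotopies: similarities `z ↦ q + μ z`, `μ > 0` (`isIsotopic_similarity`, along the path of
  similarities), shears `x ↦ x + g x • v` with `g` invariant along `v` (`isIsotopic_shear`,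
  straight-line family of shears), and **the inversion `inv3` composed with a reflection**
  (`isIsotopic_inv3_reflection`): on `φ`-images `inv3 ∘ ρ_a` is the rotation
  `ρ_{e₃} ∘ ρ_{uvec a}` of `ℝ⁴` (`phi_inv3`, `reflection_uvec_phi`), the end of the rotation
  family `reflectionPair` (`SphereIsometryDiffeotopy.lean`) through the mirrors
  `(1 - s) e₃ + s uvec a`.

## References

* M. W. Hirsch, *Differential Topology*, GTM 33 (1976), Ch. 8 §1, Thm. 1.3. [HirschDT1976]
* R. H. Crowell, R. H. Fox, *Introduction to Knot Theory* (1963), Ch. I §2. [CrowellFox1963]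

## Design notes

No named facts, no `sorry`; `𝔼 n`, `𝕊 n` are local notation as in `Knots.lean`.
-/

open scoped Manifold ContDiff Topology Real RealInnerProductSpace
open Function Set Metric Filter

noncomputable section

namespace Literature.Topology.FourManifolds

/-- Local notation: `𝔼 n` is the model Euclidean space `EuclideanSpace ℝ (Fin n)`. -/
local notation "𝔼 " n:arg => EuclideanSpace ℝ (Fin n)

/-- Local notation: `𝕊 n` is the unit sphere in `EuclideanSpace ℝ (Fin (n + 1))`. -/
local notation "𝕊 " n:arg => (Metric.sphere (0 : EuclideanSpace ℝ (Fin (n + 1))) 1)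

attribute [local instance] fact_finrank_euclideanSpace_succ

open KnotsInBall FoxMilnorModel Knot.SymmetricUnion

/-! ### Chart loops -/

/-- A **chart loop**: a `C^∞`, `1`-periodic, regular curve in `ℝ³`, injective modulo the period.
[folklore] -/
structure IsChartLoop (k : ℝ → 𝔼 3) : Prop where
  contDiff : ContDiff ℝ ∞ k
  periodic : Periodic k 1
  deriv_ne_zero : ∀ t, deriv k t ≠ 0
  inj : ∀ s t, k s = k t → ∃ m : ℤ, t - s = m

namespace IsChartLoop

variable {k : ℝ → 𝔼 3} (h : IsChartLoop k)
include h

/-- The velocity of `φ ∘ k` is the image of the velocity of `k`. [folklore] -/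
theorem deriv_phi_comp (t : ℝ) : deriv (phi ∘ k) t = fderiv ℝ phi (k t) (deriv k t) := by
  have hk : HasDerivAt k (deriv k t) t := ((h.contDiff.differentiable (by simp)) t).hasDerivAt
  exact (((contDiff_phi.differentiable (by simp)) (k t)).hasFDerivAt.comp_hasDerivAt t hk).deriv

/-- **A chart loop read through `φ` is a simple regular loop on `𝕊³`.** [folklore] -/
theorem loop : IsRegularLoop (phi ∘ k) where
  contDiff := contDiff_phi.comp h.contDiff
  periodic t := by simp [h.periodic t]
  norm_eq_one t := norm_phi _
  deriv_ne_zero t := by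
    rw [h.deriv_phi_comp]
    exact fun h0 ↦ h.deriv_ne_zero t ((injective_iff_map_eq_zero _).1 (injective_fderiv_phi (k t)) _ h0)

omit h in
/-- `φ` is injective. [folklore] -/
theorem phi_injective : Injective phi := fun w w' hw ↦ by
  have : psi.symm w = psi.symm w' := Subtype.ext hw
  have := congrArg psi this
  rwa [psi_apply_psi_symm, psi_apply_psi_symm] at this

/-- Injectivity of `φ ∘ k` modulo the period. [folklore] -/
theorem inj_phi (s t : ℝ) (hst : (phi ∘ k) s = (phi ∘ k) t) : ∃ m : ℤ, t - s = m :=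
  h.inj s t (phi_injective hst)

/-- **The knot of a chart loop.** [folklore] -/
def toKnot (h : IsChartLoop k) : Knot := h.loop.toKnot h.inj_phi

/-- The knot through `circlePt t` is `φ (k t)`. [folklore] -/
theorem coe_toKnot_circlePt (t : ℝ) : ((h.toKnot (circlePt t) : 𝕊 3) : 𝔼 4) = phi (k t) :=
  h.loop.coe_toKnot_circlePt h.inj_phi t

/-- The knot through `circlePt t` is `ψ⁻¹ (k t)`. [folklore] -/
theorem toKnot_circlePt (t : ℝ) : h.toKnot (circlePt t) = psi.symm (k t) :=
  Subtype.ext (h.coe_toKnot_circlePt t)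

/-- The knot through `circlePoint θ` is `ψ⁻¹ (k (θ / 2π))`. [folklore] -/
theorem toKnot_circlePoint (θ : ℝ) : h.toKnot (circlePoint θ) = psi.symm (k ((2 * π)⁻¹ * θ)) :=
  Subtype.ext (h.loop.coe_toKnot_circlePoint h.inj_phi θ)

/-- The knot misses the south pole. [folklore] -/
theorem toKnot_ne_southPole (x : 𝕊 1) : h.toKnot x ≠ southPole := by
  rw [← circlePt_angA x, h.toKnot_circlePt]; exact psi_symm_ne_southPole _

/-- **The chart image of the knot is the loop**: `ψ (toKnot (circlePt t)) = k t`. [folklore] -/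
theorem psi_toKnot_circlePt (t : ℝ) : psi (h.toKnot (circlePt t)) = k t := by
  rw [h.toKnot_circlePt, psi_apply_psi_symm]

/-- The same over `circlePoint`. [folklore] -/
theorem psi_toKnot_circlePoint (θ : ℝ) : psi (h.toKnot (circlePoint θ)) = k ((2 * π)⁻¹ * θ) := by
  rw [h.toKnot_circlePoint, psi_apply_psi_symm]

/-! ### Images under injective immersions -/

/-- **The image of a chart loop under an injective immersion of `ℝ³` is a chart loop.**
[folklore] -/
theorem comp_of_injective {Φ : 𝔼 3 → 𝔼 3} (hΦ : ContDiff ℝ ∞ Φ) (hinj : Injective Φ)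
    (hder : ∀ x, Injective (fderiv ℝ Φ x)) : IsChartLoop (Φ ∘ k) where
  contDiff := hΦ.comp h.contDiff
  periodic t := by simp [h.periodic t]
  deriv_ne_zero t := by
    have hk : HasDerivAt k (deriv k t) t := ((h.contDiff.differentiable (by simp)) t).hasDerivAt
    rw [(((hΦ.differentiable (by simp)) (k t)).hasFDerivAt.comp_hasDerivAt t hk).deriv]
    exact fun h0 ↦ h.deriv_ne_zero t ((injective_iff_map_eq_zero _).1 (hder (k t)) _ h0)
  inj s t hst := h.inj s t (hinj hst)

/-! ### Families of chart loops -/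

omit h in
/-- **Knots of chart loops joined by a smooth family of chart loops are isotopic.** [folklore] -/
theorem isIsotopic_of_family {k₀ k₁ : ℝ → 𝔼 3} (h₀ : IsChartLoop k₀) (h₁ : IsChartLoop k₁)
    {F : ℝ → ℝ → 𝔼 3} (hF : ContDiff ℝ ∞ (uncurry F)) (hFu : ∀ u ∈ Icc (0 : ℝ) 1, IsChartLoop (F u))
    (e₀ : F 0 = k₀) (e₁ : F 1 = k₁) : h₀.toKnot.IsIsotopic h₁.toKnot := by
  refine IsRegularLoop.isIsotopic_of_family_eq (C := fun u ↦ phi ∘ F u) h₀.loop h₁.loop h₀.inj_phi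
    h₁.inj_phi (contDiff_phi.comp hF) (fun u hu ↦ (hFu u hu).loop) (fun u hu ↦ (hFu u hu).inj_phi)
    (by rw [e₀]) (by rw [e₁])

/-! ### Similarities -/

/-- **A similar chart loop** `q + μ • k` (`μ > 0`) defines an isotopic knot (along the path of
similarities `u ↦ u • q + ((1 - u) + u μ) • k`). [folklore] -/
theorem isIsotopic_similarity (q : 𝔼 3) {μ : ℝ} (hμ : 0 < μ)
    (h' : IsChartLoop fun t ↦ q + μ • k t) : h.toKnot.IsIsotopic h'.toKnot := by
  set F : ℝ → ℝ → 𝔼 3 := fun u t ↦ u • q + ((1 - u) + u * μ) • k t with hF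
  have hF_s : ContDiff ℝ ∞ (uncurry F) :=
    (contDiff_fst.smul contDiff_const).add
      (((contDiff_const.sub contDiff_fst).add (contDiff_fst.mul contDiff_const)).smul (h.contDiff.comp contDiff_snd))
  refine isIsotopic_of_family h h' hF_s (fun u hu ↦ ?_) (by funext t; simp [hF]) (by funext t; simp [hF])
  have hc : 0 < (1 - u) + u * μ := by
    rcases eq_or_lt_of_le hu.1 with h0 | h0
    · rw [← h0]; norm_num
    · nlinarith [hu.2]
  have hΦ : ContDiff ℝ ∞ fun x : 𝔼 3 ↦ u • q + ((1 - u) + u * μ) • x :=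
    contDiff_const.add (contDiff_id.const_smul _)
  have hinj : Injective fun x : 𝔼 3 ↦ u • q + ((1 - u) + u * μ) • x := fun x y hxy ↦
    smul_right_injective _ hc.ne' (add_left_cancel hxy)
  have hder : ∀ x : 𝔼 3, Injective (fderiv ℝ (fun x : 𝔼 3 ↦ u • q + ((1 - u) + u * μ) • x) x) := by
    intro x
    have hd : HasFDerivAt (fun x : 𝔼 3 ↦ u • q + ((1 - u) + u * μ) • x)
        (((1 - u) + u * μ) • ContinuousLinearMap.id ℝ (𝔼 3)) x := by
      simpa using ((((1 - u) + u * μ) • ContinuousLinearMap.id ℝ (𝔼 3)).hasFDerivAt).const_add (u • q)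
    rw [hd.fderiv]
    intro v w hvw
    exact smul_right_injective _ hc.ne' (by simpa using hvw)
  exact h.comp_of_injective hΦ hinj hder

/-! ### Shears -/

/-- **A sheared chart loop** `k + g k • v`, `g` invariant along `v`, defines an isotopic knot
(straight-line family of shears, each a bijective immersion of `ℝ³`). [folklore] -/
theorem isIsotopic_shear {g : 𝔼 3 → ℝ} (hg : ContDiff ℝ ∞ g) (v : 𝔼 3)
    (hinv : ∀ x (s : ℝ), g (x + s • v) = g x)
    (h' : IsChartLoop fun t ↦ k t + g (k t) • v) : h.toKnot.IsIsotopic h'.toKnot := by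
  set F : ℝ → ℝ → 𝔼 3 := fun u t ↦ k t + (u * g (k t)) • v with hF
  have hF_s : ContDiff ℝ ∞ (uncurry F) :=
    (h.contDiff.comp contDiff_snd).add ((contDiff_fst.mul (hg.comp (h.contDiff.comp contDiff_snd))).smul contDiff_const)
  refine isIsotopic_of_family h h' hF_s (fun u _ ↦ ?_) (by funext t; simp [hF]) (by funext t; simp [hF])
  -- the shear `Φ_u x = x + u g x • v`
  have hΦ : ContDiff ℝ ∞ fun x : 𝔼 3 ↦ x + (u * g x) • v :=
    contDiff_id.add ((contDiff_const.mul hg).smul contDiff_const)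
  have hinj : Injective fun x : 𝔼 3 ↦ x + (u * g x) • v := by
    intro x y hxy
    simp only at hxy
    have hs : y = x + (u * g x - u * g y) • v := by
      rw [sub_smul, ← add_sub_assoc, hxy, add_sub_cancel_right]
    have hgy : g y = g x := by rw [hs, hinv]
    rw [hgy] at hxy
    exact add_right_cancel hxy
  have hder : ∀ x : 𝔼 3, Injective (fderiv ℝ (fun x : 𝔼 3 ↦ x + (u * g x) • v) x) := by
    intro x
    -- `Dg x v = 0` by invariance along `v`
    have hgd : HasFDerivAt g (fderiv ℝ g x) x := ((hg.differentiable (by simp)) x).hasFDerivAt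
    have hDgv : fderiv ℝ g x v = 0 := by
      have hl : HasDerivAt (fun s : ℝ ↦ x + s • v) v 0 := by
        simpa using ((hasDerivAt_id (0 : ℝ)).smul_const v).const_add x
      have hcomp : HasDerivAt (fun s : ℝ ↦ g (x + s • v)) (fderiv ℝ g (x + (0 : ℝ) • v) v) 0 :=
        ((hg.differentiable (by simp)) _).hasFDerivAt.comp_hasDerivAt (0 : ℝ) hl
      simp only [zero_smul, add_zero] at hcomp
      have hconst : (fun s : ℝ ↦ g (x + s • v)) = fun _ ↦ g x := funext fun s ↦ hinv x s
      rw [hconst] at hcomp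
      exact hcomp.unique (hasDerivAt_const 0 (g x))
    have hd : HasFDerivAt (fun x : 𝔼 3 ↦ x + (u * g x) • v)
        (ContinuousLinearMap.id ℝ (𝔼 3) + (u • fderiv ℝ g x).smulRight v) x := by
      have h1 : HasFDerivAt (fun x ↦ u * g x) (u • fderiv ℝ g x) x := hgd.const_mul u
      exact (hasFDerivAt_id x).add (h1.smul_const v)
    rw [hd.fderiv]
    refine (injective_iff_map_eq_zero _).2 fun w hw ↦ ?_
    have hw' : w + (u * fderiv ℝ g x w) • v = 0 := by
      simpa [ContinuousLinearMap.smulRight_apply] using hw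
    -- apply `Dg` : `Dg w + (u Dg w) Dg v = Dg w = 0`, hence `w = 0`
    have h2 : fderiv ℝ g x w = 0 := by
      have := congrArg (fderiv ℝ g x) hw'
      rw [map_add, map_smul, hDgv, smul_zero, add_zero, map_zero] at this
      exact this
    rw [h2, mul_zero, zero_smul, add_zero] at hw'
    exact hw'
  exact h.comp_of_injective hΦ hinj hder

/-! ### The inversion composed with a reflection -/

omit h in
/-- The reflection of `ℝ⁴` in `e₃⊥`, written out, is `refl4`. [folklore] -/
theorem sub_smul_e3_eq_refl4 (y : 𝔼 4) : y - (2 * ⟪e3, y⟫ / ‖e3‖ ^ 2) • e3 = refl4 y := by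
  rw [refl4_apply, projH_apply, norm_e3, one_pow, div_one, inner_e3_left]
  module

omit h in
/-- **Reflections of the chart are reflections of `ℝ⁴` on `φ`-images**, written out:
`φ w - (2 ⟪uvec a, φ w⟫ / ‖uvec a‖²) uvec a = φ (ρ_a w)`. [folklore] -/
theorem phi_sub_smul_uvec (a w : 𝔼 3) :
    phi w - (2 * ⟪uvec a, phi w⟫ / ‖uvec a‖ ^ 2) • uvec a = phi ((ℝ ∙ a)ᗮ.reflection w) := by
  have hn : ‖(ℝ ∙ a)ᗮ.reflection w‖ = ‖w‖ := LinearIsometryEquiv.norm_map _ _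
  have h1 : ⟪uvec a, phi w⟫ = (‖w‖ ^ 2 + 4)⁻¹ * (4 * ⟪a, w⟫) := by
    rw [phi_eq, inner_smul_right, inner_add_right, inner_smul_right, inner_smul_right, inner_uvec_uvec,
      inner_uvec_e3]
    ring
  have h2 : uvec ((ℝ ∙ a)ᗮ.reflection w) = uvec w - (2 * ⟪a, w⟫ / ‖a‖ ^ 2) • uvec a := by
    rw [reflection_orthogonal_singleton_apply, map_sub, LinearIsometry.map_smul]
  rw [h1, norm_uvec, phi_eq, phi_eq, hn, h2]
  module

omit h in
/-- `inv3` of a smooth nonvanishing function is smooth. [folklore] -/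
theorem contDiff_inv3_comp {f : ℝ → 𝔼 3} (hf : ContDiff ℝ ∞ f) (h0 : ∀ t, f t ≠ 0) :
    ContDiff ℝ ∞ fun t ↦ inv3 (f t) := by
  have : (fun t ↦ inv3 (f t)) = fun t ↦ (4 / ‖f t‖ ^ 2) • f t := by funext t; rw [inv3_apply]
  rw [this]
  exact (contDiff_const.div (hf.norm_sq ℝ) fun t ↦ pow_ne_zero _ (norm_ne_zero_iff.2 (h0 t))).smul hf

omit h in
/-- **A regular loop moved by a linear isometry is a regular loop.** [folklore] -/
theorem _root_.Literature.Topology.FourManifolds.IsRegularLoop.comp_linearIsometryEquiv {c₀ : ℝ → 𝔼 4}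
    (hc₀ : IsRegularLoop c₀) (L : 𝔼 4 ≃ₗᵢ[ℝ] 𝔼 4) : IsRegularLoop (fun t ↦ L (c₀ t)) where
  contDiff := L.contDiff.comp hc₀.contDiff
  periodic t := by simp [hc₀.periodic t]
  norm_eq_one t := by rw [LinearIsometryEquiv.norm_map, hc₀.norm_eq_one]
  deriv_ne_zero t := by
    have hd : HasDerivAt c₀ (deriv c₀ t) t := ((hc₀.contDiff.differentiable (by simp)) t).hasDerivAt
    have hd' : HasDerivAt (fun t ↦ L (c₀ t)) ((L : 𝔼 4 →L[ℝ] 𝔼 4) (deriv c₀ t)) t :=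
      (L : 𝔼 4 →L[ℝ] 𝔼 4).hasFDerivAt.comp_hasDerivAt t hd
    rw [hd'.deriv]
    intro h1
    apply hc₀.deriv_ne_zero t
    apply L.injective
    rw [map_zero]
    exact h1

/-- The mirror path `s ↦ (1 - s) e₃ + s uvec a`. [folklore] -/
def mirrorPath (a : 𝔼 3) (s : ℝ) : 𝔼 4 := (1 - s) • e3 + s • uvec a

omit h in
/-- The mirror path is smooth. [folklore] -/
theorem contDiff_mirrorPath (a : 𝔼 3) : ContDiff ℝ ∞ (mirrorPath a) :=
  ((contDiff_const.sub contDiff_id).smul contDiff_const).add (contDiff_id.smul contDiff_const)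

omit h in
/-- The mirror path avoids the origin (`a ≠ 0`). [folklore] -/
theorem mirrorPath_ne_zero {a : 𝔼 3} (ha : a ≠ 0) (s : ℝ) : mirrorPath a s ≠ 0 := by
  intro hs0
  have h1 : ⟪mirrorPath a s, e3⟫ = 1 - s := by
    simp only [mirrorPath, inner_add_left, inner_smul_left, RCLike.conj_to_real, inner_uvec_e3, mul_zero, add_zero,
      real_inner_self_eq_norm_sq, norm_e3, one_pow, mul_one]
  have h2 : ⟪mirrorPath a s, uvec a⟫ = s * ‖a‖ ^ 2 := by
    simp only [mirrorPath, inner_add_left, inner_smul_left, RCLike.conj_to_real, inner_e3_uvec, mul_zero, zero_add,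
      real_inner_self_eq_norm_sq, norm_uvec]
  rw [hs0, inner_zero_left] at h1 h2
  have hs1 : s = 1 := by linarith
  rw [hs1, one_mul] at h2
  exact ha (norm_eq_zero.1 (pow_eq_zero_iff two_ne_zero |>.1 h2.symm))

omit h in
/-- `mirrorPath a 0 = e₃`. [folklore] -/
theorem mirrorPath_zero (a : 𝔼 3) : mirrorPath a 0 = e3 := by simp [mirrorPath]

omit h in
/-- `mirrorPath a 1 = uvec a`. [folklore] -/
theorem mirrorPath_one (a : 𝔼 3) : mirrorPath a 1 = uvec a := by simp [mirrorPath]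

omit h in
/-- **The end of the rotation family is `inv3 ∘ ρ_a` on `φ`-images.** [folklore] -/
theorem reflectionPair_mirrorPath_one {a w : 𝔼 3} (hw : (ℝ ∙ a)ᗮ.reflection w ≠ 0) :
    reflectionPair (mirrorPath a) 1 (phi w) = phi (inv3 ((ℝ ∙ a)ᗮ.reflection w)) := by
  rw [reflectionPair_apply, reflection_orthogonal_singleton_apply, reflection_orthogonal_singleton_apply,
    mirrorPath_zero, mirrorPath_one, phi_sub_smul_uvec, sub_smul_e3_eq_refl4]
  exact (phi_inv3 hw).symm

omit h in
/-- The rotation family is jointly smooth. [folklore] -/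
theorem contDiff_reflectionPair_mirrorPath {a : 𝔼 3} (ha : a ≠ 0) :
    ContDiff ℝ ∞ fun p : ℝ × 𝔼 4 ↦ reflectionPair (mirrorPath a) p.1 p.2 := by
  have hfam : ContDiff ℝ ∞ fun p : ℝ × 𝔼 4 ↦ (ℝ ∙ mirrorPath a p.1)ᗮ.reflection p.2 :=
    contDiff_reflection_family (n := 3) (contDiff_mirrorPath a) (mirrorPath_ne_zero ha) contDiff_snd
  have hρ₀ : ContDiff ℝ ∞ fun y : 𝔼 4 ↦ (ℝ ∙ mirrorPath a 0)ᗮ.reflection y :=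
    LinearIsometryEquiv.contDiff _
  have hfun : (fun p : ℝ × 𝔼 4 ↦ reflectionPair (mirrorPath a) p.1 p.2) =
      (fun y : 𝔼 4 ↦ (ℝ ∙ mirrorPath a 0)ᗮ.reflection y) ∘
        fun p : ℝ × 𝔼 4 ↦ (ℝ ∙ mirrorPath a p.1)ᗮ.reflection p.2 := rfl
  rw [hfun]
  exact hρ₀.comp hfam

/-- The rotation family applied to a loop: `(s, t) ↦ reflectionPair (mirrorPath a) s (c₀ t)`. [folklore] -/
def rotFamily (a : 𝔼 3) (c₀ : ℝ → 𝔼 4) (s t : ℝ) : 𝔼 4 := reflectionPair (mirrorPath a) s (c₀ t)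

omit h in
/-- The rotation family of a smooth loop is jointly smooth (`a ≠ 0`). [folklore] -/
theorem contDiff_rotFamily {a : 𝔼 3} (ha : a ≠ 0) {c₀ : ℝ → 𝔼 4} (hc₀ : ContDiff ℝ ∞ c₀) :
    ContDiff ℝ ∞ (uncurry (rotFamily a c₀)) := by
  have : uncurry (rotFamily a c₀) = (fun p : ℝ × 𝔼 4 ↦ reflectionPair (mirrorPath a) p.1 p.2) ∘
      fun p : ℝ × ℝ ↦ (p.1, c₀ p.2) := rfl
  rw [this]
  exact (contDiff_reflectionPair_mirrorPath ha).comp (contDiff_fst.prodMk (hc₀.comp contDiff_snd))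

omit h in
/-- Each stage of the rotation family of a regular loop is a regular loop. [folklore] -/
theorem isRegularLoop_rotFamily (a : 𝔼 3) {c₀ : ℝ → 𝔼 4} (hc₀ : IsRegularLoop c₀) (s : ℝ) :
    IsRegularLoop (rotFamily a c₀ s) :=
  hc₀.comp_linearIsometryEquiv (reflectionPair (mirrorPath a) s)

omit h in
/-- The rotation family starts at the loop. [folklore] -/
theorem rotFamily_zero (a : 𝔼 3) (c₀ : ℝ → 𝔼 4) : rotFamily a c₀ 0 = c₀ := by
  funext t
  show reflectionPair (mirrorPath a) 0 (c₀ t) = c₀ t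
  rw [reflectionPair_zero]
  rfl

/-- **The inversion composed with a reflection preserves the knot type.** If the chart loop `k`
avoids the origin, `inv3 ∘ ρ_a ∘ k` (`a ≠ 0`) is a chart loop whose knot is isotopic to that of
`k`: on `φ`-images `inv3 ∘ ρ_a` is the rotation `ρ_{e₃} ∘ ρ_{uvec a}` of `ℝ⁴`, the end of the
rotation family through the mirrors `(1 - s) e₃ + s uvec a`. [folklore] -/
theorem isChartLoop_inv3_reflection (h0 : ∀ t, k t ≠ 0) {a : 𝔼 3} (ha : a ≠ 0) :
    IsChartLoop (fun t ↦ inv3 ((ℝ ∙ a)ᗮ.reflection (k t))) ∧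
      ∀ h' : IsChartLoop (fun t ↦ inv3 ((ℝ ∙ a)ᗮ.reflection (k t))), h.toKnot.IsIsotopic h'.toKnot := by
  have hρ0 : ∀ t, (ℝ ∙ a)ᗮ.reflection (k t) ≠ 0 := fun t h1 ↦ h0 t (by
    have := congrArg (ℝ ∙ a)ᗮ.reflection h1
    rwa [Submodule.reflection_reflection, map_zero] at this)
  have hk'c : ContDiff ℝ ∞ fun t ↦ inv3 ((ℝ ∙ a)ᗮ.reflection (k t)) :=
    contDiff_inv3_comp ((LinearIsometryEquiv.contDiff _).comp h.contDiff) hρ0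
  -- the family of loops
  have hCs : ContDiff ℝ ∞ (uncurry (rotFamily a (phi ∘ k))) := contDiff_rotFamily ha h.loop.contDiff
  have hloop : ∀ s, IsRegularLoop (rotFamily a (phi ∘ k) s) := fun s ↦ isRegularLoop_rotFamily a h.loop s
  have hinjC : ∀ s (u v : ℝ), rotFamily a (phi ∘ k) s u = rotFamily a (phi ∘ k) s v → ∃ m : ℤ, v - u = m :=
    fun s u v huv ↦ h.inj_phi u v ((reflectionPair (mirrorPath a) s).injective huv)
  -- the end loops
  have hC1 : rotFamily a (phi ∘ k) 1 = phi ∘ fun t ↦ inv3 ((ℝ ∙ a)ᗮ.reflection (k t)) :=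
    funext fun t ↦ reflectionPair_mirrorPath_one (hρ0 t)
  have hC0 : rotFamily a (phi ∘ k) 0 = phi ∘ k := rotFamily_zero a _
  have hk'loop : IsRegularLoop (phi ∘ fun t ↦ inv3 ((ℝ ∙ a)ᗮ.reflection (k t))) := by
    rw [← hC1]; exact hloop 1
  -- `k'` is a chart loop
  have hk' : IsChartLoop (fun t ↦ inv3 ((ℝ ∙ a)ᗮ.reflection (k t))) :=
    { contDiff := hk'c
      periodic := fun t ↦ by simp [h.periodic t]
      deriv_ne_zero := fun t hd0 ↦ by
        have hkd := ((hk'c.differentiable (by simp)) t).hasDerivAt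
        have h1 := (((contDiff_phi.differentiable (by simp)) _).hasFDerivAt.comp_hasDerivAt t hkd).deriv
        rw [hd0, map_zero] at h1
        exact hk'loop.deriv_ne_zero t h1
      inj := fun u v huv ↦ by
        have : rotFamily a (phi ∘ k) 1 u = rotFamily a (phi ∘ k) 1 v := by
          rw [hC1]
          exact congrArg phi huv
        exact hinjC 1 u v this }
  refine ⟨hk', fun h' ↦ ?_⟩
  exact IsRegularLoop.isIsotopic_of_family_eq h.loop h'.loop h.inj_phi h'.inj_phi hCs
    (fun s _ ↦ hloop s) (fun s _ ↦ hinjC s) hC0 hC1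

end IsChartLoop

end Literature.Topology.FourManifolds
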